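import Summits.QuantumFields.YangMills.Theorems.FluctuationComparisonRegPrIntLOrganTangentLawEdgeResponse
import Summits.QuantumFields.YangMills.Theorems.FluctuationComparisonRegPrIntLOrganTangentLawSquareResponse
import Summits.QuantumFields.YangMills.Theorems.FluctuationComparisonRegPrIntLRunpairOrganFibreLawDefs
import HarnessLib

/-!
# Crux `FluctuationComparisonRegPrIntL` (stmt-QuantumFields-20520, rung R3), PATH-B organ, H-currency cone — (L23b) DOCK of the law-edge ∕ law-square response
# calculus (✓`…OrganTangentLawEdgeResponse` (L23), ✓`…OrganTangentLawSquareResponse` (L24), both Mathlib-only) on the reviewed fibre-weight letters `wNum` ∕ `wgt`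
# of ✓`…RunpairOrganFibreLawDefs` (LEAD w3 g26, p812742)

Cell `ym3-torus` (YM ladder rung R3 = continuum `SU(2)` Yang–Mills on the three-torus — a RUNG: NOT d = 4, NOT infinite volume, NOT a mass gap, NOT Clay).
Width seat `ym-ust-20520-w5` (gen 24), `--supports stmt-QuantumFields-20520 --as helper`, count-neutral, no registry ∕ binder ∕ `Lines/` edit, DEFINITION-FREE,
default heartbeats.  Split off the calculus file at LEAD w3 g26's request (№18: «keep §1–§3 Mathlib-only … so the T⁴ cells can reuse them; ONLY §4 on the DEFS import»).

* ★`integral_mul_wgt_eq_div` — `∫ f·(wgt … t V) dτ = (∫ f·wNum … t V dτ) ∕ (∫ wNum … t V dτ)` (`wgt := wNum ∕ ∫ wNum`; Mathlib `integral_div`): every `E_{Xw}[·]` of the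
  rows `SpreadFibreLawH` ∕ `SpreadFibreLawHJ` is a `normMean` of the calculus file with `w s z := wNum … t (X s) z` along a law path `X`.
* ★`abs_lawEdge_wgt_le` — for ANY law path `X : ℝ → GaugeField (F.P j) 0 SU(2)` (e.g. the coarse bond move `X s = U₂·expPt(s•m′)@B′`) and a frozen integrand `f`:
  §1 data for `s ↦ wNum … t (X s) z` with a derivative family `wN′` on an open `U ⊇ [0,1]` + `sup_{[0,1]}` |path covariance| `≤ ℓ` ⟹
  `|∫ f·ŵ_t(X 1) dτ − ∫ f·ŵ_t(X 0) dτ| ≤ ℓ` — the (L1ʲ-h) ∕ first half of (JV3-h′) shape; the derivative family (chain rule through `Φ`, `ρ`, `ρ′`, `χ`, `J`) and the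
  ONE-LAW covariance bound `ℓ` (integrand vs. score `wN′ ∕ wNum`) are the discharger's INPUTS; `∫ wNum ≠ 0` along the path is ✓`OrganTangentFibreWeightNormalisation.wgt_normalised`.
* ★`abs_lawSquare_wgt_le` — the same over a TWO-parameter law path `X : ℝ → ℝ → GaugeField` (the coarse one-bond square `X s s′ = V00·expPt(s•m)@B·expPt(s′•m′)@B′`,
  corners `X 0 0, X 1 0, X 0 1, X 1 1 = V00, V10, V01, V11`): (L24) `abs_normMean_secondDiff_le`'s data for `w s s′ z := wNum … t (X s s′) z` with partial families
  `w₁ w₂ w₁₂` + a uniform bound `ℓ` of the N-form mixed bracket on `[0,1]²` ⟹ `|∫ f·ŵ_t(X 1 1) − ∫ f·ŵ_t(X 1 0) − ∫ f·ŵ_t(X 0 1) + ∫ f·ŵ_t(X 0 0)| ≤ ℓ` — the (L2ʲ-h) shape.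

HONEST FRAMING: bookkeeping [folklore]; no letter is priced, no cumulant bounded, no score computed; nothing of Bałaban's analysis is asserted or proved;
`SpreadFibreLawH` ∕ `SpreadFibreLawHJ` are HYPOTHESIS rows; LIN″ ∕ JVAR″ ∕ JEN″ ∕ O1ᵘ-H v2.2 ∕ S1aᴴ ∕ S3ᴴ ∕ S2α′ ∕ S2β, the five registered stubs of
`Lines/semiclassical_s2beta.lean`, crux 20520 `FluctuationComparisonRegPrIntL` and `YM3TorusSU2` are NOT proved; registry untouched; rung R3 = SU(2) YM₃ on T³ at fixed
lattice data — NOT d = 4, NOT infinite volume, NOT a mass gap, NOT Clay; the Yang–Mills mass gap is NOT proved.  [folklore].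
-/

set_option autoImplicit false

noncomputable section

namespace Summit.QuantumFields.YangMills.Theorems.OrganTangentLawEdgeResponseDock

open MeasureTheory Filter Topology Set
open scoped ENNReal
open Summit.QuantumFields.YangMills.Theorems.OrganTangentLawEdgeResponse
open Summit.QuantumFields.YangMills.Theorems.OrganTangentLawSquareResponse

section Dock

open Literature.MathematicalPhysics.QuantumFieldTheory.Balaban1983to89 T3ContinuumYM3Torus T3NestedUnitLaws T3UnitLawDensityEML T4Continuum BalabanUVClass
open Summit.QuantumFields.YangMills.Theorems.FluctuationComparisonRegPrIntLRunpairOrganFibreLaw (wNum wgt)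

/-- ★ **DOCK**: an integral against the normalised fibre weight `ŵ_t(V,·) = wgt … t V` is the quotient of the `wNum`-integrals —
`∫ f·(wgt … t V) dτ = (∫ f·wNum … t V dτ) ∕ (∫ wNum … t V dτ)` (`wgt := wNum ∕ ∫ wNum`; Mathlib `integral_div`).  So every `E_{Xw}[·]` of the rows is a
`normMean` of §1 with `w s z := wNum … t (X s) z` along any law path `X`. [folklore] -/
theorem integral_mul_wgt_eq_div (F : T3Family) (γ b₀ p₀ : ℝ) (j Ts : ℕ)
    (ρ ρ' : (i : ℕ) → GaugeField (F.P i) 0 ↥(Matrix.specialUnitaryGroup (Fin 2) ℂ) → ℝ) {Zc : Type} [MeasurableSpace Zc] (τ : Measure Zc)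
    (Φ : GaugeField (F.P j) 0 ↥(Matrix.specialUnitaryGroup (Fin 2) ℂ) × Zc → GaugeField (F.P Ts) 0 ↥(Matrix.specialUnitaryGroup (Fin 2) ℂ))
    (J : GaugeField (F.P j) 0 ↥(Matrix.specialUnitaryGroup (Fin 2) ℂ) × Zc → NNReal) (t : ℝ)
    (V : GaugeField (F.P j) 0 ↥(Matrix.specialUnitaryGroup (Fin 2) ℂ)) (f : Zc → ℝ) :
    ∫ z, f z * (wgt F γ b₀ p₀ j Ts ρ ρ' τ Φ J t) V z ∂τ
      = (∫ z, f z * wNum F γ b₀ p₀ j Ts ρ ρ' Φ J t V z ∂τ) / (∫ z, wNum F γ b₀ p₀ j Ts ρ ρ' Φ J t V z ∂τ) := by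
  rw [← integral_div]
  refine integral_congr_ae (Eventually.of_forall fun z => ?_)
  simp only [wgt]
  ring

/-- ★ **THE LAW EDGE ALONG A LAW PATH, DOCKED** (the (L1ʲ-h) ∕ first half of (JV3-h′) shape on the letters): for ANY path `X : ℝ → GaugeField` of law points
(e.g. the coarse bond move `X s = U₂·expPt(s•m′)@B′`, `X 0 = U₂`, `X 1 = W₂`) and a frozen integrand `f`, if `s ↦ wNum … t (X s) z` has an `s`-derivative family
`wN′` with the §1 data on an open `U ⊇ [0,1]` and the path covariance is `≤ ℓ` on `[0,1]`, then `|∫ f·ŵ_t(X 1) dτ − ∫ f·ŵ_t(X 0) dτ| ≤ ℓ`.  The derivative family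
`wN′` (chain rule through `Φ`, `ρ`, `ρ′`, `χ`, `J`) and the bound `ℓ` (a covariance of `f` with the score `wN′ ∕ wNum` under ONE law) are the discharger's INPUTS. [folklore] -/
theorem abs_lawEdge_wgt_le (F : T3Family) (γ b₀ p₀ : ℝ) (j Ts : ℕ)
    (ρ ρ' : (i : ℕ) → GaugeField (F.P i) 0 ↥(Matrix.specialUnitaryGroup (Fin 2) ℂ) → ℝ) {Zc : Type} [MeasurableSpace Zc] (τ : Measure Zc)
    (Φ : GaugeField (F.P j) 0 ↥(Matrix.specialUnitaryGroup (Fin 2) ℂ) × Zc → GaugeField (F.P Ts) 0 ↥(Matrix.specialUnitaryGroup (Fin 2) ℂ))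
    (J : GaugeField (F.P j) 0 ↥(Matrix.specialUnitaryGroup (Fin 2) ℂ) × Zc → NNReal) (t : ℝ)
    (X : ℝ → GaugeField (F.P j) 0 ↥(Matrix.specialUnitaryGroup (Fin 2) ℂ)) (f : Zc → ℝ) (wN' : ℝ → Zc → ℝ)
    {U : Set ℝ} (hU : IsOpen U) (hUI : Icc (0:ℝ) 1 ⊆ U)
    (hf : AEStronglyMeasurable f τ) (hmeas : ∀ s, AEStronglyMeasurable (fun z => wNum F γ b₀ p₀ j Ts ρ ρ' Φ J t (X s) z) τ)
    (hmeas' : ∀ s, AEStronglyMeasurable (wN' s) τ)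
    (hint : ∀ s ∈ Icc (0:ℝ) 1, Integrable (fun z => wNum F γ b₀ p₀ j Ts ρ ρ' Φ J t (X s) z) τ)
    (hintf : ∀ s ∈ Icc (0:ℝ) 1, Integrable (fun z => f z * wNum F γ b₀ p₀ j Ts ρ ρ' Φ J t (X s) z) τ)
    {bound : Zc → ℝ} (hbound : ∀ᵐ z ∂τ, ∀ s ∈ U, |wN' s z| ≤ bound z) (hbint : Integrable bound τ)
    {boundf : Zc → ℝ} (hboundf : ∀ᵐ z ∂τ, ∀ s ∈ U, |f z * wN' s z| ≤ boundf z) (hbfint : Integrable boundf τ)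
    (hdiff : ∀ᵐ z ∂τ, ∀ s ∈ U, HasDerivAt (fun s => wNum F γ b₀ p₀ j Ts ρ ρ' Φ J t (X s) z) (wN' s z) s)
    (hZ : ∀ s ∈ Icc (0:ℝ) 1, ∫ z, wNum F γ b₀ p₀ j Ts ρ ρ' Φ J t (X s) z ∂τ ≠ 0) {ℓ : ℝ}
    (hcov : ∀ s ∈ Icc (0:ℝ) 1, |(∫ z, f z * wN' s z ∂τ) / (∫ z, wNum F γ b₀ p₀ j Ts ρ ρ' Φ J t (X s) z ∂τ)
        - ((∫ z, f z * wNum F γ b₀ p₀ j Ts ρ ρ' Φ J t (X s) z ∂τ) / (∫ z, wNum F γ b₀ p₀ j Ts ρ ρ' Φ J t (X s) z ∂τ))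
          * ((∫ z, wN' s z ∂τ) / (∫ z, wNum F γ b₀ p₀ j Ts ρ ρ' Φ J t (X s) z ∂τ))| ≤ ℓ) :
    |(∫ z, f z * (wgt F γ b₀ p₀ j Ts ρ ρ' τ Φ J t) (X 1) z ∂τ) - (∫ z, f z * (wgt F γ b₀ p₀ j Ts ρ ρ' τ Φ J t) (X 0) z ∂τ)| ≤ ℓ := by
  rw [integral_mul_wgt_eq_div, integral_mul_wgt_eq_div]
  exact abs_normMean_one_sub_zero_le (w := fun s z => wNum F γ b₀ p₀ j Ts ρ ρ' Φ J t (X s) z) (w' := wN') hU hUI hf hmeas hmeas'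
    hint hintf hbound hbint hboundf hbfint hdiff hZ hcov

/-- ★ **THE LAW SQUARE ALONG A TWO-PARAMETER LAW PATH, DOCKED** (the (L2ʲ-h) shape on the letters): for ANY `X : ℝ → ℝ → GaugeField (F.P j) 0 SU(2)` and a frozen
integrand `f`, (L24) `abs_normMean_secondDiff_le`'s data for `w s s′ z := wNum … t (X s s′) z` (partial families `w₁ w₂ w₁₂`, dominators on an open `U ⊇ [0,1]`,
non-zero masses on `[0,1]²`) and a uniform bound `ℓ` of the N-form mixed bracket on `[0,1]²` give
`|∫ f·ŵ_t(X 1 1) dτ − ∫ f·ŵ_t(X 1 0) dτ − ∫ f·ŵ_t(X 0 1) dτ + ∫ f·ŵ_t(X 0 0) dτ| ≤ ℓ`. [folklore] -/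
theorem abs_lawSquare_wgt_le (F : T3Family) (γ b₀ p₀ : ℝ) (j Ts : ℕ)
    (ρ ρ' : (i : ℕ) → GaugeField (F.P i) 0 ↥(Matrix.specialUnitaryGroup (Fin 2) ℂ) → ℝ) {Zc : Type} [MeasurableSpace Zc] (τ : Measure Zc)
    (Φ : GaugeField (F.P j) 0 ↥(Matrix.specialUnitaryGroup (Fin 2) ℂ) × Zc → GaugeField (F.P Ts) 0 ↥(Matrix.specialUnitaryGroup (Fin 2) ℂ))
    (J : GaugeField (F.P j) 0 ↥(Matrix.specialUnitaryGroup (Fin 2) ℂ) × Zc → NNReal) (t : ℝ)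
    (X : ℝ → ℝ → GaugeField (F.P j) 0 ↥(Matrix.specialUnitaryGroup (Fin 2) ℂ)) (f : Zc → ℝ) (w₁ w₂ w₁₂ : ℝ → ℝ → Zc → ℝ)
    {U : Set ℝ} (hU : IsOpen U) (hUI : Icc (0:ℝ) 1 ⊆ U)
    (hf : AEStronglyMeasurable f τ) (hm : ∀ s s', AEStronglyMeasurable (fun z => wNum F γ b₀ p₀ j Ts ρ ρ' Φ J t (X s s') z) τ)
    (hm₁ : ∀ s s', AEStronglyMeasurable (w₁ s s') τ) (hm₂ : ∀ s s', AEStronglyMeasurable (w₂ s s') τ) (hm₁₂ : ∀ s s', AEStronglyMeasurable (w₁₂ s s') τ)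
    (hi : ∀ s ∈ Icc (0:ℝ) 1, ∀ s' ∈ Icc (0:ℝ) 1, Integrable (fun z => wNum F γ b₀ p₀ j Ts ρ ρ' Φ J t (X s s') z) τ)
    (hiG : ∀ s ∈ Icc (0:ℝ) 1, ∀ s' ∈ Icc (0:ℝ) 1, Integrable (fun z => f z * wNum F γ b₀ p₀ j Ts ρ ρ' Φ J t (X s s') z) τ)
    (hi₂ : ∀ s ∈ Icc (0:ℝ) 1, ∀ s' ∈ Icc (0:ℝ) 1, Integrable (w₂ s s') τ)
    (hiG₂ : ∀ s ∈ Icc (0:ℝ) 1, ∀ s' ∈ Icc (0:ℝ) 1, Integrable (fun z => f z * w₂ s s' z) τ)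
    {b₁ : Zc → ℝ} (hb₁ : ∀ᵐ z ∂τ, ∀ s ∈ U, ∀ s' ∈ U, |w₁ s s' z| ≤ b₁ z) (hb₁i : Integrable b₁ τ)
    {b₁G : Zc → ℝ} (hb₁G : ∀ᵐ z ∂τ, ∀ s ∈ U, ∀ s' ∈ U, |f z * w₁ s s' z| ≤ b₁G z) (hb₁Gi : Integrable b₁G τ)
    {b₂ : Zc → ℝ} (hb₂ : ∀ᵐ z ∂τ, ∀ s ∈ U, ∀ s' ∈ U, |w₂ s s' z| ≤ b₂ z) (hb₂i : Integrable b₂ τ)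
    {b₂G : Zc → ℝ} (hb₂G : ∀ᵐ z ∂τ, ∀ s ∈ U, ∀ s' ∈ U, |f z * w₂ s s' z| ≤ b₂G z) (hb₂Gi : Integrable b₂G τ)
    {b₁₂ : Zc → ℝ} (hb₁₂ : ∀ᵐ z ∂τ, ∀ s ∈ U, ∀ s' ∈ U, |w₁₂ s s' z| ≤ b₁₂ z) (hb₁₂i : Integrable b₁₂ τ)
    {b₁₂G : Zc → ℝ} (hb₁₂G : ∀ᵐ z ∂τ, ∀ s ∈ U, ∀ s' ∈ U, |f z * w₁₂ s s' z| ≤ b₁₂G z) (hb₁₂Gi : Integrable b₁₂G τ)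
    (hd₂ : ∀ᵐ z ∂τ, ∀ s ∈ U, ∀ s' ∈ U, HasDerivAt (fun s' => wNum F γ b₀ p₀ j Ts ρ ρ' Φ J t (X s s') z) (w₂ s s' z) s')
    (hd₁ : ∀ᵐ z ∂τ, ∀ s ∈ U, ∀ s' ∈ U, HasDerivAt (fun s => wNum F γ b₀ p₀ j Ts ρ ρ' Φ J t (X s s') z) (w₁ s s' z) s)
    (hd₁₂ : ∀ᵐ z ∂τ, ∀ s ∈ U, ∀ s' ∈ U, HasDerivAt (fun s => w₂ s s' z) (w₁₂ s s' z) s)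
    (hZ : ∀ s ∈ Icc (0:ℝ) 1, ∀ s' ∈ Icc (0:ℝ) 1, ∫ z, wNum F γ b₀ p₀ j Ts ρ ρ' Φ J t (X s s') z ∂τ ≠ 0) {ℓ : ℝ}
    (hb : ∀ s ∈ Icc (0:ℝ) 1, ∀ s' ∈ Icc (0:ℝ) 1,
      |(((∫ z, f z * w₁₂ s s' z ∂τ) / (∫ z, wNum F γ b₀ p₀ j Ts ρ ρ' Φ J t (X s s') z ∂τ)
          - ((∫ z, f z * w₂ s s' z ∂τ) / (∫ z, wNum F γ b₀ p₀ j Ts ρ ρ' Φ J t (X s s') z ∂τ))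
            * ((∫ z, w₁ s s' z ∂τ) / (∫ z, wNum F γ b₀ p₀ j Ts ρ ρ' Φ J t (X s s') z ∂τ)))
        - ((((∫ z, f z * w₁ s s' z ∂τ) / (∫ z, wNum F γ b₀ p₀ j Ts ρ ρ' Φ J t (X s s') z ∂τ)
              - ((∫ z, f z * wNum F γ b₀ p₀ j Ts ρ ρ' Φ J t (X s s') z ∂τ) / (∫ z, wNum F γ b₀ p₀ j Ts ρ ρ' Φ J t (X s s') z ∂τ))
                * ((∫ z, w₁ s s' z ∂τ) / (∫ z, wNum F γ b₀ p₀ j Ts ρ ρ' Φ J t (X s s') z ∂τ)))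
            * ((∫ z, w₂ s s' z ∂τ) / (∫ z, wNum F γ b₀ p₀ j Ts ρ ρ' Φ J t (X s s') z ∂τ)))
          + ((∫ z, f z * wNum F γ b₀ p₀ j Ts ρ ρ' Φ J t (X s s') z ∂τ) / (∫ z, wNum F γ b₀ p₀ j Ts ρ ρ' Φ J t (X s s') z ∂τ))
            * ((∫ z, w₁₂ s s' z ∂τ) / (∫ z, wNum F γ b₀ p₀ j Ts ρ ρ' Φ J t (X s s') z ∂τ)
              - ((∫ z, w₂ s s' z ∂τ) / (∫ z, wNum F γ b₀ p₀ j Ts ρ ρ' Φ J t (X s s') z ∂τ))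
                * ((∫ z, w₁ s s' z ∂τ) / (∫ z, wNum F γ b₀ p₀ j Ts ρ ρ' Φ J t (X s s') z ∂τ)))))| ≤ ℓ) :
    |(∫ z, f z * (wgt F γ b₀ p₀ j Ts ρ ρ' τ Φ J t) (X 1 1) z ∂τ) - (∫ z, f z * (wgt F γ b₀ p₀ j Ts ρ ρ' τ Φ J t) (X 1 0) z ∂τ)
      - (∫ z, f z * (wgt F γ b₀ p₀ j Ts ρ ρ' τ Φ J t) (X 0 1) z ∂τ) + (∫ z, f z * (wgt F γ b₀ p₀ j Ts ρ ρ' τ Φ J t) (X 0 0) z ∂τ)| ≤ ℓ := by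
  rw [integral_mul_wgt_eq_div, integral_mul_wgt_eq_div, integral_mul_wgt_eq_div, integral_mul_wgt_eq_div]
  exact abs_normMean_secondDiff_le (w := fun s s' z => wNum F γ b₀ p₀ j Ts ρ ρ' Φ J t (X s s') z) (w₁ := w₁) (w₂ := w₂) (w₁₂ := w₁₂) hU hUI hf hm hm₁
    hm₂ hm₁₂ hi hiG hi₂ hiG₂ hb₁ hb₁i hb₁G hb₁Gi hb₂ hb₂i hb₂G hb₂Gi hb₁₂ hb₁₂i hb₁₂G hb₁₂Gi hd₂ hd₁ hd₁₂ hZ hb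

end Dock


end Summit.QuantumFields.YangMills.Theorems.OrganTangentLawEdgeResponseDock

end
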